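import Summits.NavierStokesRegularity.FluidComputer.FamilySymmetry
import HarnessLib

/-!
# Every member of Ohkitani's family has the Taylor–Green point symmetries

HONEST FRAMING: typed infrastructure for a low prior, high value-of-information experiment on
Tao's machine paradigm; NOT a claim that NS blows up.

The Taylor–Green vortex "is invariant under six discrete symmetry transformations" which the
symmetric spectral codes exploit [cite: Frisch1983LesHouches, p. 464 (Les Houches XXXVI, 1981)];
`LatticeSymmetry` (this tree) types the three mirrors and the half-turn for `tg`
(`reflX_act_tg`, `reflY_act_tg`, `reflZ_act_tg`, `rotZpi_act_tg`) and their persistence along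
Galerkin runs.  The same holds for EVERY member `(A, B, -(A+B))` of Ohkitani's family
[cite: Ohkitani2001ODEEnstrophy, eq. (22)] — its coefficient `(i/8) c_j k_j` on `{±1}³` is odd in
`k_j` and even in the other two entries — so the mirror group, hence the symmetry reduction and the
symmetry meters of the cell's codes, apply verbatim to the members the exact-series tools use:

* `reflX_act_fam`, `reflY_act_fam`, `reflZ_act_fam`, `rotZpi_act_fam`: the three mirrors and the
  half-turn about `z` fix `fam A B`;
* `rotZ_act_fam`: the quarter-turn about `z` maps `fam(A,B,C)` to `fam(B,A,C)` (for Taylor–Green,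
  `(1,-1,0) ↦ (-1,1,0) = -tg`, recovering `rotZ_act_tg`);
* persistence along every unforced Galerkin run on a mode set mapped into itself
  (`fam_reflX_persists`, `fam_reflY_persists`, `fam_reflZ_persists`, `fam_rotZpi_persists`), by
  `LatticeIsometry.act_eq_self`.

0 sorry, 0 named facts.
-/

noncomputable section

namespace Summit.NavierStokesRegularity.FluidComputer.FamilySymmetry

open Literature.Analysis.FluidPDE.FluidComputer
open Literature.Analysis.FluidPDE.FluidComputer.ShellTransfer
open Literature.Analysis.FluidPDE.FluidComputer.ShellTransfer.TaylorGreenHat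
open Complex
open scoped BigOperators

/-! ## The mirrors and the half-turn fix every member -/

/-- **`reflX · fam(A,B) = fam(A,B)`** (`x ↦ -x`). [folklore] -/
theorem reflX_act_fam (A B : ℝ) :
    reflX.act (TaylorGreenFamily.fam A B) = TaylorGreenFamily.fam A B := by
  refine fourierVelocity_ext ?_
  funext k i
  rw [LatticeIsometry.act_coeff, reflX_invK]
  simp only [TaylorGreenFamily.coeff_eq_ite, reflX_invK_mem_modes_iff]
  by_cases hk : k ∈ modes
  · simp only [if_pos hk]
    unfold reflX
    fin_cases i <;> simp [Fin.sum_univ_three, neg_div]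
  · simp only [if_neg hk, mul_zero, Finset.sum_const_zero]

/-- **`reflY · fam(A,B) = fam(A,B)`** (`y ↦ -y`). [folklore] -/
theorem reflY_act_fam (A B : ℝ) :
    reflY.act (TaylorGreenFamily.fam A B) = TaylorGreenFamily.fam A B := by
  refine fourierVelocity_ext ?_
  funext k i
  rw [LatticeIsometry.act_coeff, reflY_invK]
  simp only [TaylorGreenFamily.coeff_eq_ite, reflY_invK_mem_modes_iff]
  by_cases hk : k ∈ modes
  · simp only [if_pos hk]
    unfold reflY
    fin_cases i <;> simp [Fin.sum_univ_three, neg_div]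
  · simp only [if_neg hk, mul_zero, Finset.sum_const_zero]

/-- **`reflZ · fam(A,B) = fam(A,B)`** (`z ↦ -z`). [folklore] -/
theorem reflZ_act_fam (A B : ℝ) :
    reflZ.act (TaylorGreenFamily.fam A B) = TaylorGreenFamily.fam A B := by
  refine fourierVelocity_ext ?_
  funext k i
  rw [LatticeIsometry.act_coeff, reflZ_invK]
  simp only [TaylorGreenFamily.coeff_eq_ite, reflZ_invK_mem_modes_iff]
  by_cases hk : k ∈ modes
  · simp only [if_pos hk]
    unfold reflZ
    fin_cases i <;> simp [Fin.sum_univ_three, neg_div]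
  · simp only [if_neg hk, mul_zero, Finset.sum_const_zero]

/-- **`rotZpi · fam(A,B) = fam(A,B)`** (half-turn `(x,y) ↦ (-x,-y)`). [folklore] -/
theorem rotZpi_act_fam (A B : ℝ) :
    rotZpi.act (TaylorGreenFamily.fam A B) = TaylorGreenFamily.fam A B := by
  refine fourierVelocity_ext ?_
  funext k i
  rw [LatticeIsometry.act_coeff, rotZpi_invK]
  simp only [TaylorGreenFamily.coeff_eq_ite, rotZpi_invK_mem_modes_iff]
  by_cases hk : k ∈ modes
  · simp only [if_pos hk]
    unfold rotZpi
    fin_cases i <;> simp [Fin.sum_univ_three, neg_div]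
  · simp only [if_neg hk, mul_zero, Finset.sum_const_zero]

/-- **`rotZ · fam(A,B,C) = fam(B,A,C)`**: the quarter-turn about `z` exchanges the first two
parameters (no sign, unlike `swapXY`'s action on `tg` written as `-tg = fam(-1,1,0)`). [folklore] -/
theorem rotZ_act_fam (A B : ℝ) :
    rotZ.act (TaylorGreenFamily.fam A B) = TaylorGreenFamily.fam B A := by
  refine fourierVelocity_ext ?_
  funext k i
  rw [LatticeIsometry.act_coeff, rotZ_invK]
  simp only [TaylorGreenFamily.coeff_eq_ite, rotZ_vec_mem_tgModes_iff]
  by_cases hk : k ∈ modes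
  · simp only [if_pos hk]
    unfold rotZ
    fin_cases i <;> simp [Fin.sum_univ_three, neg_div, add_comm]
  · simp only [if_neg hk, mul_zero, Finset.sum_const_zero]

/-! ## Persistence along Galerkin runs -/

variable {U : ℝ → FourierVelocity} {S : Finset (Fin 3 → ℤ)} {ν : ℝ} {c : ℝ → (Fin 3 → ℤ) → ℂ}
  {A B : ℝ} {t₀ : ℝ}

/-- **PERSISTENCE, `x ↦ -x`.** Every unforced Galerkin run (any `ν`) supported in a mode set mapped
into itself by `reflX` that passes through a family member is `reflX`-invariant at all times.
[folklore] -/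
theorem fam_reflX_persists (hU : IsGalerkinSolution U S ν c fun _ _ _ => 0) (hs : IsSupportedOn U S)
    (hS : ∀ p ∈ S, reflX.invK p ∈ S) (hS' : ∀ p ∈ S, reflX.actK p ∈ S)
    (h0 : U t₀ = TaylorGreenFamily.fam A B) (t : ℝ) : reflX.act (U t) = U t :=
  reflX.act_eq_self hU hs hS hS' (by rw [h0, reflX_act_fam]) t

/-- **PERSISTENCE, `y ↦ -y`.** [folklore] -/
theorem fam_reflY_persists (hU : IsGalerkinSolution U S ν c fun _ _ _ => 0) (hs : IsSupportedOn U S)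
    (hS : ∀ p ∈ S, reflY.invK p ∈ S) (hS' : ∀ p ∈ S, reflY.actK p ∈ S)
    (h0 : U t₀ = TaylorGreenFamily.fam A B) (t : ℝ) : reflY.act (U t) = U t :=
  reflY.act_eq_self hU hs hS hS' (by rw [h0, reflY_act_fam]) t

/-- **PERSISTENCE, `z ↦ -z`.** [folklore] -/
theorem fam_reflZ_persists (hU : IsGalerkinSolution U S ν c fun _ _ _ => 0) (hs : IsSupportedOn U S)
    (hS : ∀ p ∈ S, reflZ.invK p ∈ S) (hS' : ∀ p ∈ S, reflZ.actK p ∈ S)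
    (h0 : U t₀ = TaylorGreenFamily.fam A B) (t : ℝ) : reflZ.act (U t) = U t :=
  reflZ.act_eq_self hU hs hS hS' (by rw [h0, reflZ_act_fam]) t

/-- **PERSISTENCE, half-turn about `z`.** [folklore] -/
theorem fam_rotZpi_persists (hU : IsGalerkinSolution U S ν c fun _ _ _ => 0)
    (hs : IsSupportedOn U S) (hS : ∀ p ∈ S, rotZpi.invK p ∈ S)
    (hS' : ∀ p ∈ S, rotZpi.actK p ∈ S) (h0 : U t₀ = TaylorGreenFamily.fam A B) (t : ℝ) :
    rotZpi.act (U t) = U t :=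
  rotZpi.act_eq_self hU hs hS hS' (by rw [h0, rotZpi_act_fam]) t

end Summit.NavierStokesRegularity.FluidComputer.FamilySymmetry

end
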